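import Mathlib
import Summits.Ventures.DiscreteObjects.Mahler.TrinomialFactors

/-!
# Ljunggren's theorem on `±1`-trinomials (venture `DiscreteObjects`, target L)

Cell `pub-namedobj`, seat `pub-namedobj-mahler` (gen 10). Framing: lottery ticket; floor = certified
bounds/negative ranges.

**Theorem** (W. Ljunggren, *On the irreducibility of certain trinomials and quadrinomials*,
Math. Scand. 8 (1960) 65–70, Thm 3; see also [McKee–Smyth, *Around the Unit Circle*, Exercise 12.4]).
Let `T = zⁿ + a zᵐ + b` with `a, b = ±1`, `0 < m < n`.  Then `T = (∏_{d ∈ S} Φ_d) · R` where `R = 1` or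
`R` is irreducible (and nonreciprocal); equivalently, in any factorisation of `T` into irreducible
integer polynomials all factors but at most one are `±Φ_d`.

Kernel route.
* An irreducible common factor `f` of `T` and its mirror `T⁎ = b zⁿ + a z^{n-m} + 1` divides
  `T - b T⁎ = a zᵐ - ab z^{n-m}`; as `f(0) ≠ 0` this gives `f ∣ z^{2|n-2m|} - 1` when `n ≠ 2m`; when
  `n = 2m`, `b = -1` is impossible (`f ∣ 2zᵐ`) and for `b = 1`, `T ∈ {Φ₃(zᵐ), Φ₆(zᵐ)}` divides
  `z^{3m} - 1` or `z^{6m} - 1`.  An irreducible divisor of `z^k - 1 = ∏_{d ∣ k} Φ_d` is `±Φ_d`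
  (`dvd_X_pow_sub_one_of_dvd_trinomial_mirror`, `eq_cyclotomic_of_irreducible_dvd_X_pow_sub_one`).
* Hence every reciprocal or antireciprocal irreducible factor of `T` is `±Φ_d`
  (`trinomial_reciprocal_factor_cyclotomic`), and a cyclotomic-free `T` is relatively prime to its
  mirror, so irreducible by Ljunggren's lemma as formalised in Mathlib
  (`Polynomial.IsUnitTrinomial.irreducible_of_coprime`): `irreducible_trinomial_of_cyclotomicFree`.
* In general Smyth's inequality with Landau's bound `M(T) ≤ √3 < θ₀²` (gen 9,
  `card_nonreciprocal_factors_trinomial_le_one`) leaves at most one nonreciprocal factor: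
  `ljunggren_factorisation` (any factorisation into irreducibles) and `ljunggren_trinomial`
  (`T = (∏ Φ_d) · R`, `R = 1` or `R` irreducible, nonreciprocal and cyclotomic-free).
-/

namespace Summit.Ventures.DiscreteObjects.Mahler

open Polynomial

/-! ### Algebraic lemmas in `ℤ[X]` -/

/-- A divisor of `X` in `ℤ[X]` with nonzero constant term is a unit. -/
theorem isUnit_of_dvd_X_of_coeff_zero_ne_zero {f : ℤ[X]} (hf0 : f.coeff 0 ≠ 0)
    (h : f ∣ (X : ℤ[X])) : IsUnit f := by
  obtain ⟨g, hg⟩ := h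
  have hg0 : g.coeff 0 = 0 := by
    have h0 := congrArg (fun p : ℤ[X] => p.coeff 0) hg
    simp only [coeff_X_zero, mul_coeff_zero] at h0
    rcases mul_eq_zero.mp h0.symm with h | h
    · exact absurd h hf0
    · exact h
  obtain ⟨g', hg'⟩ := X_dvd_iff.mpr hg0
  have h1 : (X : ℤ[X]) * 1 = X * (f * g') := by
    rw [mul_one]
    conv_lhs => rw [hg, hg']
    ring
  exact IsUnit.of_mul_eq_one g' (mul_left_cancel₀ X_ne_zero h1).symm

/-- A prime `f ∈ ℤ[X]` with `f(0) ≠ 0` dividing `X^e · g` divides `g`. -/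
theorem dvd_of_dvd_X_pow_mul {f g : ℤ[X]} (hf : Prime f) (hf0 : f.coeff 0 ≠ 0) {e : ℕ}
    (h : f ∣ X ^ e * g) : f ∣ g := by
  rcases hf.dvd_or_dvd h with h1 | h1
  · exact absurd (isUnit_of_dvd_X_of_coeff_zero_ne_zero hf0 (hf.dvd_of_dvd_pow h1)) hf.not_unit
  · exact h1

/-- An irreducible integer polynomial dividing `X^k - 1` (`k ≥ 1`) is `±Φ_d` for some `d ∣ k`. -/
theorem eq_cyclotomic_of_irreducible_dvd_X_pow_sub_one {f : ℤ[X]} (hirr : Irreducible f) {k : ℕ}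
    (hk : 0 < k) (hdvd : f ∣ X ^ k - 1) :
    ∃ d : ℕ, 0 < d ∧ d ∣ k ∧ (f = cyclotomic d ℤ ∨ f = -cyclotomic d ℤ) := by
  have hprime : Prime f := UniqueFactorizationMonoid.irreducible_iff_prime.mp hirr
  rw [← prod_cyclotomic_eq_X_pow_sub_one hk ℤ] at hdvd
  obtain ⟨d, hd, hfd⟩ := hprime.exists_mem_finset_dvd hdvd
  have hdpos : 0 < d := Nat.pos_of_mem_divisors hd
  have hdk : d ∣ k := Nat.dvd_of_mem_divisors hd
  have hass : Associated f (cyclotomic d ℤ) :=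
    hirr.associated_of_dvd (cyclotomic.irreducible hdpos) hfd
  obtain ⟨u, hu⟩ := hass
  obtain ⟨c, hc, hcu⟩ := Polynomial.isUnit_iff.mp u.isUnit
  refine ⟨d, hdpos, hdk, ?_⟩
  rcases Int.isUnit_iff.mp hc with h | h
  · left
    rw [← hu, ← hcu, h, map_one, mul_one]
  · right
    rw [← hu, ← hcu, h, map_neg, map_one, mul_neg, mul_one, neg_neg]

/-! ### The trinomial `Xⁿ + aXᵐ + b` and its mirror -/

/-- `Xⁿ + aXᵐ + b` as a Mathlib `trinomial`. -/
theorem trinomial_eq_pm (m n : ℕ) (a b : ℤ) :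
    trinomial 0 m n b a 1 = (X ^ n + C a * X ^ m + C b : ℤ[X]) := by
  rw [trinomial_def, map_one, one_mul, pow_zero, mul_one]
  ring

/-- The mirror (reciprocal polynomial) of `T = Xⁿ + aXᵐ + b` (`b ≠ 0`, `0 < m < n`) is
`bXⁿ + aX^{n-m} + 1`. -/
theorem mirror_trinomial_pm {m n : ℕ} (hm : 0 < m) (hmn : m < n) (a : ℤ) {b : ℤ} (hb : b ≠ 0) :
    (X ^ n + C a * X ^ m + C b : ℤ[X]).mirror = C b * X ^ n + C a * X ^ (n - m) + 1 := by
  rw [← trinomial_eq_pm, trinomial_mirror hm hmn hb one_ne_zero, trinomial_def]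
  simp only [add_zero, map_one, one_mul, pow_zero]
  ring

/-- A divisor of `Xⁿ + aXᵐ + b` (`b ≠ 0`) has nonzero constant term. -/
theorem coeff_zero_ne_zero_of_dvd_trinomial {n m : ℕ} (hm : 0 < m) (hmn : m < n) (a : ℤ) {b : ℤ}
    (hb : b ≠ 0) {f : ℤ[X]} (hdvd : f ∣ X ^ n + C a * X ^ m + C b) : f.coeff 0 ≠ 0 := by
  obtain ⟨g, hg⟩ := hdvd
  intro h
  have h0 : (trinomial 0 m n b a 1 : ℤ[X]).coeff 0 = b := trinomial_trailing_coeff' hm hmn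
  rw [trinomial_eq_pm, hg, mul_coeff_zero, h, zero_mul] at h0
  exact hb h0.symm

/-- **An irreducible common factor of a `±1`-trinomial and its mirror divides some `X^k - 1`.**
For `T = Xⁿ + aXᵐ + b` (`a, b = ±1`, `0 < m < n`) and `f` irreducible with `f ∣ T`, `f ∣ T.mirror`:
`f ∣ X^k - 1` for some `k ≥ 1`. -/
theorem dvd_X_pow_sub_one_of_dvd_trinomial_mirror {n m : ℕ} (hm : 0 < m) (hmn : m < n) {a b : ℤ}
    (ha : a = 1 ∨ a = -1) (hb : b = 1 ∨ b = -1) {f : ℤ[X]} (hirr : Irreducible f)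
    (h1 : f ∣ X ^ n + C a * X ^ m + C b) (h2 : f ∣ (X ^ n + C a * X ^ m + C b : ℤ[X]).mirror) :
    ∃ k : ℕ, 0 < k ∧ f ∣ X ^ k - 1 := by
  have hb0 : b ≠ 0 := by rcases hb with h | h <;> simp [h]
  have hprime : Prime f := UniqueFactorizationMonoid.irreducible_iff_prime.mp hirr
  have hf0 : f.coeff 0 ≠ 0 := coeff_zero_ne_zero_of_dvd_trinomial hm hmn a hb0 h1
  rw [mirror_trinomial_pm hm hmn a hb0] at h2
  -- `f ∣ T - b·T⁎`
  have hE : f ∣ (X ^ n + C a * X ^ m + C b) - C b * (C b * X ^ n + C a * X ^ (n - m) + 1) :=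
    dvd_sub h1 (dvd_mul_of_dvd_right h2 _)
  rcases Nat.lt_trichotomy (2 * m) n with hlt | heq | hgt
  · -- `n > 2m`: `X^m (X^{2j} - 1) = (T - bT⁎)·(-a (1 + bX^j))` with `j = n - 2m`
    obtain ⟨j, hjpos, rfl⟩ : ∃ j, 0 < j ∧ n = m + m + j := ⟨n - 2 * m, by omega, by omega⟩
    have hnm : m + m + j - m = m + j := by omega
    rw [hnm] at hE
    have hid : (X : ℤ[X]) ^ m * (X ^ (2 * j) - 1) =
        ((X ^ (m + m + j) + C a * X ^ m + C b) - C b * (C b * X ^ (m + m + j) + C a * X ^ (m + j) + 1))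
          * (-(C a * (1 + C b * X ^ j))) := by
      rcases ha with rfl | rfl <;> rcases hb with rfl | rfl <;> simp only [map_one, map_neg] <;> ring
    refine ⟨2 * j, by omega, dvd_of_dvd_X_pow_mul hprime hf0 (e := m) ?_⟩
    rw [hid]
    exact dvd_mul_of_dvd_left hE _
  · -- `n = 2m`
    subst heq
    have hnm : 2 * m - m = m := by omega
    rw [hnm] at hE
    rcases hb with rfl | rfl
    · -- `b = 1`: `T = X^{2m} + aX^m + 1` divides `X^{3m} - 1` (`a = 1`) or `X^{6m} - 1` (`a = -1`)
      rcases ha with rfl | rfl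
      · refine ⟨3 * m, by omega, ?_⟩
        have hid : (X : ℤ[X]) ^ (3 * m) - 1 = (X ^ (2 * m) + C 1 * X ^ m + C 1) * (X ^ m - 1) := by
          simp only [map_one]; ring
        rw [hid]
        exact dvd_mul_of_dvd_left h1 _
      · refine ⟨6 * m, by omega, ?_⟩
        have hid : (X : ℤ[X]) ^ (6 * m) - 1 =
            (X ^ (2 * m) + C (-1) * X ^ m + C 1) * ((X ^ m + 1) * (X ^ (3 * m) - 1)) := by
          simp only [map_one, map_neg]; ring
        rw [hid]
        exact dvd_mul_of_dvd_left h1 _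
    · -- `b = -1`: `f ∣ 2X^m`, so `f ∣ 2` is a constant dividing the monic `T`: impossible
      exfalso
      have hid : (X ^ (2 * m) + C a * X ^ m + C (-1) : ℤ[X]) -
          C (-1) * (C (-1) * X ^ (2 * m) + C a * X ^ m + 1) = X ^ m * C (2 * a) := by
        simp only [map_neg, map_one, map_mul, map_ofNat]; ring
      rw [hid] at hE
      have h2a : f ∣ C (2 * a) := dvd_of_dvd_X_pow_mul hprime hf0 hE
      have ha0 : (2 * a : ℤ) ≠ 0 := by rcases ha with h | h <;> simp [h]
      have hdeg : f.natDegree = 0 := by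
        have := natDegree_le_of_dvd h2a (by rwa [Ne, C_eq_zero])
        rwa [natDegree_C, Nat.le_zero] at this
      rw [eq_C_of_natDegree_eq_zero hdeg] at h1 hirr
      have hmonic : (X ^ (2 * m) + C a * X ^ m + C (-1) : ℤ[X]).Monic := by
        rw [← trinomial_eq_pm]; exact trinomial_monic hm hmn
      have hc1 : f.coeff 0 ∣ 1 := by
        have := (C_dvd_iff_dvd_coeff _ _).mp h1 (2 * m)
        rwa [← trinomial_eq_pm, trinomial_leading_coeff' hm hmn] at this
      exact hirr.not_isUnit (isUnit_C.mpr (isUnit_of_dvd_one hc1))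
  · -- `n < 2m`: `X^e (X^{2j} - 1) = (T - bT⁎)·(a (X^j + b))` with `e = n - m`, `j = 2m - n`
    obtain ⟨e, j, hepos, hjpos, rfl, rfl⟩ :
        ∃ e j, 0 < e ∧ 0 < j ∧ m = e + j ∧ n = e + e + j :=
      ⟨n - m, 2 * m - n, by omega, by omega, by omega, by omega⟩
    have hnm : e + e + j - (e + j) = e := by omega
    rw [hnm] at hE
    have hid : (X : ℤ[X]) ^ e * (X ^ (2 * j) - 1) =
        ((X ^ (e + e + j) + C a * X ^ (e + j) + C b) - C b * (C b * X ^ (e + e + j) + C a * X ^ e + 1))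
          * (C a * (X ^ j + C b)) := by
      rcases ha with rfl | rfl <;> rcases hb with rfl | rfl <;> simp only [map_one, map_neg] <;> ring
    refine ⟨2 * j, by omega, dvd_of_dvd_X_pow_mul hprime hf0 (e := e) ?_⟩
    rw [hid]
    exact dvd_mul_of_dvd_left hE _

/-- An irreducible common factor of a `±1`-trinomial and its mirror is `±Φ_d`. -/
theorem trinomial_common_factor_cyclotomic {n m : ℕ} (hm : 0 < m) (hmn : m < n) {a b : ℤ}
    (ha : a = 1 ∨ a = -1) (hb : b = 1 ∨ b = -1) {f : ℤ[X]} (hirr : Irreducible f)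
    (h1 : f ∣ X ^ n + C a * X ^ m + C b) (h2 : f ∣ (X ^ n + C a * X ^ m + C b : ℤ[X]).mirror) :
    ∃ d : ℕ, 0 < d ∧ (f = cyclotomic d ℤ ∨ f = -cyclotomic d ℤ) := by
  obtain ⟨k, hk, hfk⟩ := dvd_X_pow_sub_one_of_dvd_trinomial_mirror hm hmn ha hb hirr h1 h2
  obtain ⟨d, hd, -, hfd⟩ := eq_cyclotomic_of_irreducible_dvd_X_pow_sub_one hirr hk hfk
  exact ⟨d, hd, hfd⟩

/-- **Reciprocal (or antireciprocal) irreducible factors of `±1`-trinomials are cyclotomic:** if `f` is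
irreducible, `f ∣ Xⁿ + aXᵐ + b` (`a, b = ±1`, `0 < m < n`) and `f.reverse = ±f`, then `f = ±Φ_d` for some
`d ≥ 1`. -/
theorem trinomial_reciprocal_factor_cyclotomic {n m : ℕ} (hm : 0 < m) (hmn : m < n) {a b : ℤ}
    (ha : a = 1 ∨ a = -1) (hb : b = 1 ∨ b = -1) {f : ℤ[X]} (hirr : Irreducible f)
    (hdvd : f ∣ X ^ n + C a * X ^ m + C b) (hrec : f.reverse = f ∨ f.reverse = -f) :
    ∃ d : ℕ, 0 < d ∧ (f = cyclotomic d ℤ ∨ f = -cyclotomic d ℤ) := by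
  have hb0 : b ≠ 0 := by rcases hb with h | h <;> simp [h]
  have hf0 : f.coeff 0 ≠ 0 := coeff_zero_ne_zero_of_dvd_trinomial hm hmn a hb0 hdvd
  have hmir : f.mirror = f.reverse := by
    rw [Polynomial.mirror, natTrailingDegree_eq_zero.mpr (Or.inr hf0), pow_zero, mul_one]
  have h2 : f ∣ (X ^ n + C a * X ^ m + C b : ℤ[X]).mirror := by
    obtain ⟨g, hg⟩ := hdvd
    rw [hg, mirror_mul_of_domain, hmir]
    rcases hrec with h | h
    · rw [h]
      exact dvd_mul_right f _
    · rw [h, neg_mul]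
      exact (dvd_mul_right f _).neg_right
  exact trinomial_common_factor_cyclotomic hm hmn ha hb hirr hdvd h2

/-- **Ljunggren: a cyclotomic-free `±1`-trinomial is irreducible.**  If no `Φ_d` (`d ≥ 1`) divides
`T = Xⁿ + aXᵐ + b` (`a, b = ±1`, `0 < m < n`), then `T` is irreducible over `ℤ` — `T` is then relatively
prime to its mirror, and Mathlib's `IsUnitTrinomial.irreducible_of_coprime` (Ljunggren's lemma) applies. -/
theorem irreducible_trinomial_of_cyclotomicFree {n m : ℕ} (hm : 0 < m) (hmn : m < n) {a b : ℤ}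
    (ha : a = 1 ∨ a = -1) (hb : b = 1 ∨ b = -1)
    (hcf : ∀ d : ℕ, 0 < d → ¬ cyclotomic d ℤ ∣ X ^ n + C a * X ^ m + C b) :
    Irreducible (X ^ n + C a * X ^ m + C b : ℤ[X]) := by
  have hua : IsUnit a := by rcases ha with h | h <;> rw [h] <;> simp
  have hub : IsUnit b := by rcases hb with h | h <;> rw [h] <;> simp
  have hunit : (X ^ n + C a * X ^ m + C b : ℤ[X]).IsUnitTrinomial := by
    obtain ⟨ua, hua⟩ := hua
    obtain ⟨ub, hub⟩ := hub
    exact ⟨0, m, n, hm, hmn, ub, ua, 1, by rw [← trinomial_eq_pm, hua, hub, Units.val_one]⟩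
  refine hunit.irreducible_of_coprime fun g hg1 hg2 => ?_
  by_contra hgu
  have hg0 : g ≠ 0 := ne_zero_of_dvd_ne_zero hunit.ne_zero hg1
  obtain ⟨f, hfirr, hfg⟩ := WfDvdMonoid.exists_irreducible_factor hgu hg0
  obtain ⟨d, hd, hfd⟩ :=
    trinomial_common_factor_cyclotomic hm hmn ha hb hfirr (hfg.trans hg1) (hfg.trans hg2)
  refine hcf d hd ?_
  rcases hfd with h | h
  · rw [← h]
    exact hfg.trans hg1
  · rw [← neg_neg (cyclotomic d ℤ), ← h]
    exact (hfg.trans hg1).neg_left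

/-- **Ljunggren's theorem, factorisation form.**  In any factorisation of `Xⁿ + aXᵐ + b` (`a, b = ±1`,
`0 < m < n`) into irreducible integer polynomials (a multiset `F` with `∏ F = T`), every factor is
`±Φ_d` or nonreciprocal (`f.reverse ≠ ±f`), and at most ONE factor, counted with multiplicity, is not
reciprocal/antireciprocal — i.e. all factors but at most one are `±Φ_d`. -/
theorem ljunggren_factorisation {n m : ℕ} (hm : 0 < m) (hmn : m < n) {a b : ℤ} (ha : a = 1 ∨ a = -1)
    (hb : b = 1 ∨ b = -1) {F : Multiset ℤ[X]} (hF : ∀ f ∈ F, Irreducible f)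
    (hprod : F.prod = X ^ n + C a * X ^ m + C b) :
    (∀ f ∈ F, (∃ d : ℕ, 0 < d ∧ (f = cyclotomic d ℤ ∨ f = -cyclotomic d ℤ)) ∨
        (f.reverse ≠ f ∧ f.reverse ≠ -f)) ∧
      Multiset.card (F.filter fun f => ¬ (f.reverse = f ∨ f.reverse = -f)) ≤ 1 := by
  have hb0 : b ≠ 0 := by rcases hb with h | h <;> simp [h]
  have hdvd : ∀ f ∈ F, f ∣ X ^ n + C a * X ^ m + C b := fun f hf => hprod ▸ Multiset.dvd_prod hf
  refine ⟨fun f hf => ?_, ?_⟩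
  · by_cases hrec : f.reverse = f ∨ f.reverse = -f
    · exact Or.inl (trinomial_reciprocal_factor_cyclotomic hm hmn ha hb (hF f hf) (hdvd f hf) hrec)
    · push Not at hrec
      exact Or.inr hrec
  · refine card_nonreciprocal_factors_trinomial_le_one hm hmn ha hb (fun f hf => (hF f hf).ne_zero)
      hprod (Multiset.filter_le _ F) fun f hf => ?_
    rw [Multiset.mem_filter] at hf
    obtain ⟨hfF, hrec⟩ := hf
    push Not at hrec
    exact ⟨coeff_zero_ne_zero_of_dvd_trinomial hm hmn a hb0 (hdvd f hfF), hrec.1, hrec.2⟩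

/-- A product of polynomials each of the form `±Φ_d` is `±∏ Φ_d`. -/
theorem multiset_prod_eq_pm_prod_cyclotomic {H : Multiset ℤ[X]}
    (hH : ∀ f ∈ H, ∃ d : ℕ, 0 < d ∧ (f = cyclotomic d ℤ ∨ f = -cyclotomic d ℤ)) :
    ∃ S : Multiset ℕ, (∀ d ∈ S, 0 < d) ∧
      (H.prod = (S.map fun d => cyclotomic d ℤ).prod ∨
        H.prod = -(S.map fun d => cyclotomic d ℤ).prod) := by
  induction H using Multiset.induction_on with
  | empty => exact ⟨0, by simp, Or.inl (by simp)⟩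
  | cons f H ih =>
    obtain ⟨S, hS, hHS⟩ := ih (fun g hg => hH g (Multiset.mem_cons_of_mem hg))
    obtain ⟨d, hd, hfd⟩ := hH f (Multiset.mem_cons_self f H)
    refine ⟨d ::ₘ S, fun x hx => ?_, ?_⟩
    · rcases Multiset.mem_cons.mp hx with rfl | hx
      · exact hd
      · exact hS x hx
    · rw [Multiset.prod_cons, Multiset.map_cons, Multiset.prod_cons]
      rcases hfd with h | h <;> rcases hHS with h' | h' <;> rw [h, h']
      · exact Or.inl rfl
      · exact Or.inr (by ring)
      · exact Or.inr (by ring)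
      · exact Or.inl (by ring)

/-- **Ljunggren's theorem** [Ljunggren 1960, Thm 3]: for `a, b = ±1` and `0 < m < n`,
`Xⁿ + aXᵐ + b = (∏_{d ∈ S} Φ_d) · R` for a multiset `S` of positive integers and `R = 1` or `R`
irreducible over `ℤ`; in the latter case `R` is nonreciprocal (`R.reverse ≠ ±R`) and cyclotomic-free, so
`∏_{d ∈ S} Φ_d` is exactly the cyclotomic part of the trinomial and `R` its non-cyclotomic part. -/
theorem ljunggren_trinomial {n m : ℕ} (hm : 0 < m) (hmn : m < n) {a b : ℤ} (ha : a = 1 ∨ a = -1)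
    (hb : b = 1 ∨ b = -1) :
    ∃ (S : Multiset ℕ) (R : ℤ[X]), (∀ d ∈ S, 0 < d) ∧
      X ^ n + C a * X ^ m + C b = (S.map fun d => cyclotomic d ℤ).prod * R ∧
      (R = 1 ∨ (Irreducible R ∧ R.reverse ≠ R ∧ R.reverse ≠ -R ∧
        ∀ d : ℕ, 0 < d → ¬ cyclotomic d ℤ ∣ R)) := by
  have hb0 : b ≠ 0 := by rcases hb with h | h <;> simp [h]
  have hmonic : (X ^ n + C a * X ^ m + C b : ℤ[X]).Monic := by
    rw [← trinomial_eq_pm]; exact trinomial_monic hm hmn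
  have hT0 : (X ^ n + C a * X ^ m + C b : ℤ[X]) ≠ 0 := hmonic.ne_zero
  -- a factorisation into irreducibles: `T = (∏ F) · c`, `c = ±1`
  obtain ⟨u, hu⟩ := UniqueFactorizationMonoid.factors_prod hT0
  obtain ⟨c, hc, hcu⟩ := Polynomial.isUnit_iff.mp u.isUnit
  set F : Multiset ℤ[X] := UniqueFactorizationMonoid.factors (X ^ n + C a * X ^ m + C b : ℤ[X])
    with hFdef
  have hFirr : ∀ f ∈ F, Irreducible f := fun f hf => UniqueFactorizationMonoid.irreducible_of_factor f hf
  have hc1 : c = 1 ∨ c = -1 := Int.isUnit_iff.mp hc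
  have hCc0 : (C c : ℤ[X]) ≠ 0 := by rw [Ne, C_eq_zero]; rcases hc1 with h | h <;> simp [h]
  have hprod' : (C c ::ₘ F).prod = X ^ n + C a * X ^ m + C b := by
    rw [Multiset.prod_cons, hcu, mul_comm, hu]
  have hdvd : ∀ f ∈ F, f ∣ X ^ n + C a * X ^ m + C b := fun f hf =>
    (Multiset.dvd_prod hf).trans ⟨↑u, hu.symm⟩
  -- split `F` into (anti)reciprocal factors `H` and nonreciprocal ones `G`
  set G : Multiset ℤ[X] := F.filter fun f => ¬ (f.reverse = f ∨ f.reverse = -f) with hGdef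
  set H : Multiset ℤ[X] := F.filter fun f => f.reverse = f ∨ f.reverse = -f with hHdef
  have hHG : H + G = F := Multiset.filter_add_not _ F
  have hcard : Multiset.card G ≤ 1 := by
    refine card_nonreciprocal_factors_trinomial_le_one hm hmn ha hb (F := C c ::ₘ F) (G := G)
      (fun f hf => ?_) hprod' ((Multiset.filter_le _ F).trans (Multiset.le_cons_self F (C c)))
      fun f hf => ?_
    · rcases Multiset.mem_cons.mp hf with rfl | hf
      · exact hCc0
      · exact (hFirr f hf).ne_zero
    · rw [hGdef, Multiset.mem_filter] at hf
      obtain ⟨hfF, hrec⟩ := hf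
      push Not at hrec
      exact ⟨coeff_zero_ne_zero_of_dvd_trinomial hm hmn a hb0 (hdvd f hfF), hrec.1, hrec.2⟩
  have hH : ∀ f ∈ H, ∃ d : ℕ, 0 < d ∧ (f = cyclotomic d ℤ ∨ f = -cyclotomic d ℤ) := by
    intro f hf
    rw [hHdef, Multiset.mem_filter] at hf
    exact trinomial_reciprocal_factor_cyclotomic hm hmn ha hb (hFirr f hf.1) (hdvd f hf.1) hf.2
  obtain ⟨S, hS, hHS⟩ := multiset_prod_eq_pm_prod_cyclotomic hH
  set P : ℤ[X] := (S.map fun d => cyclotomic d ℤ).prod with hPdef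
  have hPmonic : P.Monic := monic_multiset_prod_of_monic _ _ fun d _ => cyclotomic.monic d ℤ
  -- `T = H.prod · G.prod · c`
  have hTeq : (X ^ n + C a * X ^ m + C b : ℤ[X]) = H.prod * G.prod * C c := by
    rw [← hu, ← hcu, ← hHG, Multiset.prod_add]
  -- `H.prod · c = ±P`
  have hsign : ∃ s : ℤ, (s = 1 ∨ s = -1) ∧ H.prod * C c = C s * P := by
    rcases hHS with h | h <;> rcases hc1 with h' | h'
    · exact ⟨1, Or.inl rfl, by rw [h, h', map_one]; ring⟩
    · exact ⟨-1, Or.inr rfl, by rw [h, h', map_neg, map_one]; ring⟩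
    · exact ⟨-1, Or.inr rfl, by rw [h, h', map_neg, map_one]; ring⟩
    · exact ⟨1, Or.inl rfl, by rw [h, h', map_neg, map_one]; ring⟩
  obtain ⟨s, hs, hHc⟩ := hsign
  have hTeq' : (X ^ n + C a * X ^ m + C b : ℤ[X]) = P * (C s * G.prod) := by
    rw [hTeq, mul_right_comm, hHc]; ring
  rcases Nat.le_one_iff_eq_zero_or_eq_one.mp hcard with h0 | h1
  · -- no nonreciprocal factor: `T = ±P`, and the sign is `+` by monicity
    have hG0 : G = 0 := Multiset.card_eq_zero.mp h0
    rw [hG0, Multiset.prod_zero, mul_one] at hTeq'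
    refine ⟨S, 1, hS, ?_, Or.inl rfl⟩
    rw [mul_one, ← hPdef]
    rcases hs with rfl | rfl
    · rw [hTeq', map_one, mul_one]
    · exfalso
      have hlc := congrArg Polynomial.leadingCoeff hTeq'
      rw [hmonic.leadingCoeff, map_neg, map_one, mul_neg, mul_one, leadingCoeff_neg,
        hPmonic.leadingCoeff] at hlc
      norm_num at hlc
  · -- exactly one nonreciprocal factor `g`: `R = ±g`
    obtain ⟨g, hGg⟩ := Multiset.card_eq_one.mp h1
    have hgG : g ∈ G := by rw [hGg]; exact Multiset.mem_singleton_self g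
    have hgF : g ∈ F ∧ ¬ (g.reverse = g ∨ g.reverse = -g) := by
      rw [hGdef, Multiset.mem_filter] at hgG; exact hgG
    obtain ⟨hgF, hgrec⟩ := hgF
    push Not at hgrec
    rw [hGg, Multiset.prod_singleton] at hTeq'
    set R : ℤ[X] := C s * g with hRdef
    have hRg : R = g ∨ R = -g := by
      rcases hs with h | h
      · left; rw [hRdef, h, map_one, one_mul]
      · right; rw [hRdef, h, map_neg, map_one, neg_one_mul]
    have hRirr : Irreducible R := by
      rcases hRg with h | h
      · rw [h]; exact hFirr g hgF
      · rw [h, ← neg_one_mul]; exact (irreducible_isUnit_mul isUnit_one.neg).mpr (hFirr g hgF)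
    have hRrec : R.reverse ≠ R ∧ R.reverse ≠ -R := by
      rcases hRg with h | h
      · rw [h]; exact hgrec
      · rw [h, reverse_neg, neg_neg]
        exact ⟨fun h' => hgrec.1 (neg_inj.mp h'), fun h' => hgrec.2 (neg_eq_iff_eq_neg.mp h')⟩
    have hRdvd : R ∣ X ^ n + C a * X ^ m + C b := ⟨P, by rw [hTeq', mul_comm]⟩
    have hR0 : R.coeff 0 ≠ 0 := coeff_zero_ne_zero_of_dvd_trinomial hm hmn a hb0 hRdvd
    refine ⟨S, R, hS, by rw [← hPdef, hTeq'], Or.inr ⟨hRirr, hRrec.1, hRrec.2, fun d hd hdR => ?_⟩⟩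
    -- a cyclotomic divisor of the irreducible `R` would force `M(R) = 1 < θ₀ ≤ M(R)`
    have hass : Associated (cyclotomic d ℤ) R := (cyclotomic.irreducible hd).associated_of_dvd hRirr hdR
    obtain ⟨v, hv⟩ := hass
    obtain ⟨c', hc', hcv⟩ := Polynomial.isUnit_iff.mp v.isUnit
    have hMv : intMahlerMeasure (↑v : ℤ[X]) = 1 := by
      rw [← hcv]
      unfold intMahlerMeasure
      rw [map_C, mahlerMeasure_const, eq_intCast, Complex.norm_intCast]
      rcases Int.isUnit_iff.mp hc' with h | h <;> simp [h]
    have hMR : intMahlerMeasure R = 1 := by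
      rw [← hv, intMahlerMeasure_mul, intMahlerMeasure_cyclotomic, hMv, one_mul]
    have hθ := intMahlerMeasure_ge_smythTheta_of_nonreciprocal hR0 hRrec.1 hRrec.2
    have hθ1 := smythTheta_gt
    linarith

end Summit.Ventures.DiscreteObjects.Mahler
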